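import Mathlib
import HarnessLib
import Literature.MathematicalPhysics.QuantumFieldTheory.Balaban1983to89.B10
import Literature.MathematicalPhysics.QuantumFieldTheory.Balaban1983to89.B10Eq11Trace
import Literature.MathematicalPhysics.QuantumFieldTheory.Balaban1983to89.B7Prop2Explicit
import Literature.MathematicalPhysics.QuantumFieldTheory.Balaban1983to89.B7Eq50Linear

/-!
# `Balaban1983to89.B10Eq70Squaring` — [Balaban1985UV3] p. 273, **(70)** and **(71)**: *"Squaring both sides of the
# above inequality and using (67) yields (70) … This inequality can be written finally as (71) … ≥ ¼p²(g_j) for g_j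
# sufficiently small"* — the SQUARING STEP of Sect. D PROVED on the concrete `ℤ^d` plaquette geometry of
# `B7Prop1Explicit` (Jensen over the block, Cauchy–Schwarz over the sub-plaquettes of a translated big plaquette,
# the multiplicity count, `Δ′ =` the four `j`-blocks), closing cell GAPS C-B10-2

T. Bałaban, *Ultraviolet stability of three-dimensional lattice pure gauge field theories*, Commun. Math. Phys. **102**,
255–275 (1985) [Balaban1985UV3] (cell paper B10; lit key `paper:balaban1985-cmp102-uv-stability-3d`, journal page =
PDF page + 254; page re-read for this file on the render
`run/shared/lean/pub/pub-balaban/b2b-balaban-ref1/pages/1985-cmp102-uv-stability-3d/…-p019-x2.png` (p. 273) and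
`…-p020-x2.png` (p. 274), 2026-08-21).

HONEST FRAMING (mega-formalization `lit-balaban`, verbatim): statement-level skeleton of published theorems with
citation tags; proofs where landed; nothing here is a claim about the Yang–Mills mass gap.

WHY THIS FILE EXISTS.  Unit `lit-balaban-r07` (reader/typer of B10), gen 6; SKELETON rows B10.Eq70 / B10.Eq71.  The
cell module `…B10` kernel-checks of (70) only the CROSS-TERM arithmetic `(s + b)² ≤ s² + (2AB + B²)`
(`B10.eq70_sq_step`, whose docstring records: *"the remaining step s² ≤ Σ_x L^{−j} Σ_p |·|² is Cauchy–Schwarz over the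
L^{2j} fine plaquettes of a block plaquette (cell GAPS C-B10-2)"*) and of (71) only the last inequality
(`B10.eq71_arith`).  This module proves the WHOLE printed chain (69) ∧ (67) ∧ (68) ⇒ (70) ⇒ (71) on the concrete
objects, with (69), (67), (68) entering AS PRINTED HYPOTHESES ((69) is row B10.Eq69, being proved concretely by the
Phase-2 seat p29 in `B10Eq69Concrete`; (68) is the regularity of the minimizer `U_k` from [7]; (67) is the constraint
`Ū_k^j = V_j` on `Λ_j` of the variational problem (42)).

THE PRINTED TEXT (p. 273 [19], verbatim).  *"To prove the inequality (5) we have to produce all small factors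
connected with large fields regions P in the functions ζ_{Λ_j}. Let us take a plaquette p′ ⊂ Λ_j and such that
|V_j(∂p′) − 1| ≥ g_jp(g_j). We have  Ū_k^j = V_j on Λ_j, (67)  and the configuration U_k satisfies the following
regularity condition on B^j(Λ_j).  |U_k(∂p) − 1| < O(1)g_jp(q_j)L^{−2j} ⟦sic: p(g_j)⟧. (68)  Applying the inequalities
(50), (53) [4], we have  |Ū_k^j(∂p′) − 1| < Σ_{x∈B^j(x₀)} L^{−3j} Σ_{p⊂(p′)_x} |U_k(∂p) − 1| + O(1)(g_jp(g_j))², (69)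
where p′ = ⟨x₀, y₀, z₀, w₀⟩, (p′)_x denotes the plaquette p′ transported parallelly to the point x, i.e. the lower
left corner coincides with the point x. Squaring both sides of the above inequality and using (67) yields
|V_j(∂p′) − 1|² < Σ_{x∈B^j(x₀)} L^{−j} Σ_{p⊂(p′)_x} |U_k(∂p) − 1|² + O(1)(g_jp(g_j))³
≤ 2 Σ_{p⊂Δ′} L^j[1 − Re tr U_k(∂p)] + O(1)(g_jp(g_j))³, (70)  where Δ′ = B^j(x₀) ∪ B^j(y₀) ∪ B^j(z₀) ∪ B^j(w₀).
This inequality can be written finally as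
(1/g_k²) Σ_{p⊂Δ′} η⁻¹[1 − Re tr U_k(∂p)] ≥ (1/2g_j²)|V_j(∂p′) − 1|² − O(1)g_jp³(g_j) ≥ ½p²(g_j) − O(1)g_jp³(g_j)
≥ ¼p²(g_j) (71)  for g_j sufficiently small. Thus the part of the action 1/g_k²A^η(U_k) localized to the sum of four
j-blocks Δ′ connected with the plaquette p′ can be bounded from below by 1/4p²(g_j), and the corresponding part of
the exponential gives the small factor exp(−1/4p²(g_j))."*  Context (p. 256 [2], p. 266 [12]): `η = L^{−k}`,
`g_k = g(L^kε)^{1/2}` (so `g_k² = g_j²L^{k−j}`), `A^η(U) = Σ_{p⊂T_η} η⁻¹[1 − Re tr U(∂p)]`; (11) p. 258 [4]: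
`1 − Re tr U(∂p) = ½|U(∂p) − 1|²` (tree: `B10Eq11Trace.eq11_normalized` in the normalized Hilbert–Schmidt reading,
`B10Eq11Trace.eq11_opNorm` = the inequality `|U − 1|²_op ≤ 2N(1 − Re tr U)` in the operator-norm reading of
[Balaban1985Averaging] (19); cell DIVERGENCE D-b10.1).

DICTIONARY print ↦ Lean (objects of `B7Prop1Explicit` / `B7Prop2Explicit`, all lattices identified with `ℤ^d`).
The fine lattice `T_η` ↦ `Site d = ℤ^d`, `U_k` ↦ `U : Site d → Fin d → 𝔸ˣ`, `|U_k(∂p) − 1|` for the plaquette `p`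
with lower-left corner `y` spanned by `e_μ, e_ν` ↦ `dev U μ ν y = ‖hol U y (plaqWord μ ν) − 1‖`.  The `L^jη`-lattice
`T^{(j)}` ↦ `ℤ^d` again (`B7Prop2Explicit.rescale`), its site `z₀` lying over the fine site `x₀ = n•z₀`, `n = L^j`;
`p′ = ⟨x₀, y₀, z₀, w₀⟩` ↦ the level-`j` plaquette at `z₀` spanned by `e_μ, e_ν` (`μ ≠ ν`), so on the fine lattice
`y₀ = x₀ + n e_μ`, `z₀ = x₀ + n e_μ + n e_ν`, `w₀ = x₀ + n e_ν`; `Ū_k^j(∂p′)` ↦ `hol (avgIter L U j) z₀ (plaqWord μ ν)`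
(the concrete `j`-fold average (43) of [4]); `V_j(∂p′)` ↦ `hol Vj z₀ (plaqWord μ ν)`.  `B^j(x₀)` ↦ the fine sites
`x₀ + boxVec n r`, `r : Fin d → Fin n` (weight `L^{−3j}` ↦ `(n^d)⁻¹`, general `d`); the sub-plaquettes `p ⊂ (p′)_x`
of the translate of `p′` to `x` ↦ the `n²` fine plaquettes at corners `x + i e_μ + i′ e_ν`, `i, i′ < n` (exactly the
summation set of the Stokes formula `B7Prop1Explicit.stokes` behind (48)–(50) of [4]); the pair (x, p) ↦ an index
`t = (r, i, i′) : Idx d n` with corner `corner n x₀ μ ν t`; the double sum of (69) ↦ `blockSum n x₀ μ ν F`;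
`Δ′` ↦ `deltaBox n x₀ μ ν` = the fine corners `y` with `0 ≤ (y − x₀)_κ < 2n` for `κ ∈ {μ, ν}` and `< n` otherwise,
PROVED equal to the union of the four blocks (`deltaBox_eq_union_blocks`); "p ⊂ Δ′" is read as "lower-left corner in
Δ′, p parallel to p′" — every sub-plaquette of every translate is of this kind (`corner_mem_deltaBox`), and since
`1 − Re tr U(∂p) ≥ 0` any larger plaquette set only strengthens (71).

WHAT THIS FILE PROVES (kernel, no `sorry`, no new named fact; axioms standard).
* §1 `sq_wsum_le_wsum_sq` (Jensen: `(Σ w f)² ≤ Σ w f²` for probability weights), `sum_comp_le_mul_sum` (a sum over a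
  map with fibres of size `≤ m` into a set `t` is `≤ m·Σ_t` for non-negative summands).
* §2 the geometry: `corner_mem_deltaBox`, `card_fiber_corner_le` (**each fine plaquette is a sub-plaquette of at most
  `n²` translates `(p′)_x`, `x ∈ B^j(x₀)`** — the multiplicity behind the `L^j` of (70) line 2), `mem_block`,
  `deltaBox_eq_union_blocks` (**`Δ′ = B^j(x₀) ∪ B^j(y₀) ∪ B^j(z₀) ∪ B^j(w₀)`**).
* §3 **(70)**: `blockSum_sq_le_line1` (`S² ≤ (n^d)⁻¹n² Σ_x Σ_{p⊂(p′)_x} |U_k(∂p) − 1|²`, the printed `L^{−j}` at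
  `d = 3`), `sum_idx_le_deltaBox` (`Σ_x Σ_{p⊂(p′)_x} G(p) ≤ n² Σ_{p⊂Δ′} G(p)`), `blockSum_sq_le` (`S² ≤ (n^d)⁻¹n⁴
  Σ_{p⊂Δ′}|U_k(∂p) − 1|²`, the printed `L^{j}`), `ineq70` (both printed lines with the remainder `2AB + B²` of
  `B10.eq70_sq_step`, `A = O(1)g_jp(g_j)` from (68), `B = O(1)(g_jp(g_j))²` the remainder of (69)), `ineq70_act` (line 2
  through any action density with `|U(∂p) − 1|² ≤ 2·[1 − Re tr U(∂p)]`), `ineq70_d3` (the printed exponents).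
* §4 **(71)**: `ineq71_chain` — the three printed inequalities with `g_k² = g_j²L^{k−j}`, `η⁻¹ = L^k`, O(1) explicit,
  the last one `B10.eq71_arith`.
* §5 the statement in the vocabulary of [4]/(42): `smallFactor_of_largeField` — for a large-field plaquette `p′` of
  `V_j` ((67): `Ū_k^j(∂p′) = V_j(∂p′)`), under (68) and (69), **the part of `(1/g_k²)A^η(U_k)` localized in `Δ′` is
  `≥ ¼p²(g_j)`**, hence the factor `exp(−¼p²(g_j))` (`exp_localized_le`); `d = 3`.
* §6 the hypothesis `|U(∂p) − 1|² ≤ 2·act(p)` DISCHARGED for `U(N)`-valued configurations in the operator-norm reading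
  with `act(p) = N(1 − Re tr U(∂p))` (`dev_sq_le_two_act_unitary`, from `B10Eq11Trace.eq11_opNorm`).

v1.1 (same unit, append-only §7): the BRIDGE to the kept sum of [4] (50) as landed meanwhile in `B7Eq50Linear` (seat p29
gen 4, p247559): `blockSum n x₀ μ ν (dev U μ ν) = B7Eq50Linear.blockFineAvg n U x₀ μ ν` (`blockSum_dev_eq_blockFineAvg`;
`innerSum_dev_eq_fineSum`), so that a (69) stated with `blockFineAvg (L^j) U (L^j•z₀) μ ν` — the form of p29's
`B10Eq69Concrete` — feeds (70)/(71) by `rw`; and the NON-STRICT variants `sq_le_of_le69` / `smallFactor_of_largeField_le`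
(hypothesis (69) with `≤`, as B7 (50)/(51) are certified with `≤` in the tree; print has `<`).

READING NOTES.  (a) Print's first line of (70) carries `L^{−j} = L^{−3j}·L^{2j}`: Jensen over the `L^{3j}` block
points (weights `L^{−3j}`) and Cauchy–Schwarz over the `L^{2j}` sub-plaquettes of one translate; the second line's
`L^{j} = L^{−j}·L^{2j}` is the multiplicity: a fine plaquette parallel to `p′` with corner `y` lies in `(p′)_x` exactly
for the `x ∈ y − {0,…,n−1}e_μ − {0,…,n−1}e_ν` that belong to `B^j(x₀)` — at most `n² = L^{2j}` of them.  In general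
`d` the two factors are `n^{2−d}` and `n^{4−d}` (here `(n^d)⁻¹n²`, `(n^d)⁻¹n⁴`).  (b) The cross terms: with `s ≤ A =
C₁g_jp(g_j)` ((68) summed with the probability weights over `n²` sub-plaquettes each `≤ C₁g_jp(g_j)n⁻²`) and `b ≤ B =
C₂(g_jp(g_j))²`, `2AB + B² ≤ (2C₁C₂ + C₂²)(g_jp(g_j))³` for `g_jp(g_j) ≤ 1` — the printed `O(1)(g_jp(g_j))³`.
(c) "for g_j sufficiently small" = `½(2C₁C₂ + C₂²)·g_jp(g_j) ≤ ¼` (hypothesis `hsmall`).  Value = SKELETON rows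
B10.Eq70/B10.Eq71 gain kernel-checked members on the concrete geometry; NOT summit progress.
-/

noncomputable section

open scoped BigOperators
open Finset

namespace Literature.MathematicalPhysics.QuantumFieldTheory.Balaban1983to89.B10Eq70Squaring

open B7Prop1Explicit B7Prop2Explicit

-- `Site` alone would resolve to the torus sites of `Setup.lean` (parent namespace beats `open`); re-export the
-- `ℤ^d` sites of `B7Prop1Explicit` into this namespace (same device as in `B7Prop2Explicit`).
export B7Prop1Explicit (Site)

/-! ## §1 Two finite-sum inequalities (the unprinted content of *"Squaring both sides"*) -/

section Abstract

variable {ι : Type*}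

/-- Jensen's inequality for the square with respect to probability weights: `(Σ_i w_i f_i)² ≤ Σ_i w_i f_i²` for
`w_i ≥ 0`, `Σ_i w_i = 1` (Cauchy–Schwarz with `√w_i` and `√w_i f_i`).  Used with the block weights `L^{−3j}` of (69):
the first unprinted step of *"Squaring both sides of the above inequality"*. [cite: Balaban1985UV3, (70) p.273] -/
theorem sq_wsum_le_wsum_sq (s : Finset ι) (w f : ι → ℝ) (hw : ∀ i ∈ s, 0 ≤ w i)
    (hw1 : ∑ i ∈ s, w i = 1) : (∑ i ∈ s, w i * f i) ^ 2 ≤ ∑ i ∈ s, w i * f i ^ 2 := by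
  have h := Finset.sum_mul_sq_le_sq_mul_sq s (fun i => Real.sqrt (w i)) (fun i => Real.sqrt (w i) * f i)
  have e1 : ∑ i ∈ s, Real.sqrt (w i) * (Real.sqrt (w i) * f i) = ∑ i ∈ s, w i * f i :=
    Finset.sum_congr rfl fun i hi => by rw [← mul_assoc, Real.mul_self_sqrt (hw i hi)]
  have e2 : ∑ i ∈ s, Real.sqrt (w i) ^ 2 = 1 := by
    rw [← hw1]; exact Finset.sum_congr rfl fun i hi => Real.sq_sqrt (hw i hi)
  have e3 : ∑ i ∈ s, (Real.sqrt (w i) * f i) ^ 2 = ∑ i ∈ s, w i * f i ^ 2 :=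
    Finset.sum_congr rfl fun i hi => by rw [mul_pow, Real.sq_sqrt (hw i hi)]
  rw [e1, e2, e3, one_mul] at h
  exact h

/-- Multiplicity bound: if `φ` maps `s` into `t` with fibres of cardinality `≤ m`, then for `F ≥ 0` on `t`,
`Σ_{x∈s} F(φ x) ≤ m · Σ_{y∈t} F(y)`.  Used with `φ` = (block point, sub-plaquette) ↦ fine plaquette: the unprinted
step from line 1 to line 2 of (70). [cite: Balaban1985UV3, (70) p.273] -/
theorem sum_comp_le_mul_sum {α β : Type*} [DecidableEq β] (s : Finset α) (t : Finset β) (φ : α → β)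
    (hφ : ∀ x ∈ s, φ x ∈ t) (F : β → ℝ) (hF : ∀ y ∈ t, 0 ≤ F y) (m : ℕ)
    (hm : ∀ y ∈ t, (s.filter fun x => φ x = y).card ≤ m) :
    ∑ x ∈ s, F (φ x) ≤ (m : ℝ) * ∑ y ∈ t, F y := by
  rw [← Finset.sum_fiberwise_of_maps_to hφ, Finset.mul_sum]
  refine Finset.sum_le_sum fun y hy => ?_
  have hc : ∑ x ∈ s.filter (fun x => φ x = y), F (φ x) = ((s.filter fun x => φ x = y).card : ℝ) * F y := by
    rw [Finset.sum_congr rfl (fun x hx => by rw [(Finset.mem_filter.mp hx).2]), Finset.sum_const, nsmul_eq_mul]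
  rw [hc]
  exact mul_le_mul_of_nonneg_right (Nat.cast_le.mpr (hm y hy)) (hF y hy)

end Abstract

/-! ## §2 The geometry of (69)–(70) on the fine lattice `ℤ^d`: block, translated plaquettes, sub-plaquettes, `Δ′` -/

section Geometry

variable {d : ℕ}

/-- The index set of the double sum of (69)/(70): `x ∈ B^j(x₀)` ↦ the block offset `r : Fin d → Fin n`
(`x = x₀ + boxVec n r`, as in (42) of [4]), `p ⊂ (p′)_x` ↦ `(i, i′) : Fin n × Fin n` (the fine plaquette with
lower-left corner `x + i e_μ + i′ e_ν`, as in the Stokes formula behind (48) of [4]); `n = L^j`.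
[cite: Balaban1985UV3, (69) p.273] -/
abbrev Idx (d n : ℕ) : Type := (Fin d → Fin n) × Fin n × Fin n

variable (n : ℕ) (x₀ : Site d) (μ ν : Fin d)

/-- The lower-left corner of the sub-plaquette `p ⊂ (p′)_x` indexed by `t = (r, i, i′)`:
`x₀ + boxVec n r + i e_μ + i′ e_ν`. [cite: Balaban1985UV3, (69) p.273] -/
def corner (t : Idx d n) : Site d :=
  x₀ + boxVec n t.1 + ((t.2.1 : ℕ) : ℤ) • e μ + ((t.2.2 : ℕ) : ℤ) • e ν

/-- Side lengths of the box `Δ′`: `2n` in the two directions of `p′`, `n` in the others. [cite: Balaban1985UV3, (70) p.273] -/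
def side (κ : Fin d) : ℕ := if κ = μ ∨ κ = ν then 2 * n else n

/-- `Δ′` of (70) as a set of fine sites (lower-left corners): `{y : 0 ≤ (y − x₀)_κ < side κ}` — equal to
`B^j(x₀) ∪ B^j(y₀) ∪ B^j(z₀) ∪ B^j(w₀)` (`deltaBox_eq_union_blocks`). [cite: Balaban1985UV3, (70) p.273] -/
def deltaBox : Finset (Site d) :=
  (Fintype.piFinset fun κ => Finset.range (side n μ ν κ)).image fun v => x₀ + fun κ => (v κ : ℤ)

/-- The `j`-block `B^j(x) = {x + boxVec n r}` of the fine lattice ((2) of [4] with `n = L^j`), as a set of sites.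
[cite: Balaban1985Averaging, (2) p.17] -/
def block (x : Site d) : Finset (Site d) :=
  (Finset.univ : Finset (Fin d → Fin n)).image fun r => x + boxVec n r

/-- Membership in `Δ′` by coordinates. [cite: Balaban1985UV3, (70) p.273] -/
theorem mem_deltaBox {y : Site d} :
    y ∈ deltaBox n x₀ μ ν ↔ ∀ κ, 0 ≤ (y - x₀) κ ∧ (y - x₀) κ < side n μ ν κ := by
  constructor
  · intro h κ
    obtain ⟨v, hv, rfl⟩ := Finset.mem_image.mp h
    have hvκ := Finset.mem_range.mp (Fintype.mem_piFinset.mp hv κ)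
    simp only [add_sub_cancel_left]
    exact ⟨by positivity, by exact_mod_cast hvκ⟩
  · intro h
    refine Finset.mem_image.mpr ⟨fun κ => ((y - x₀) κ).toNat, ?_, ?_⟩
    · refine Fintype.mem_piFinset.mpr fun κ => Finset.mem_range.mpr ?_
      have h1 := (h κ).1
      have h2 := (h κ).2
      omega
    · funext κ
      have h1 := (h κ).1
      simp only [Pi.add_apply, Pi.sub_apply] at h1 ⊢
      omega

/-- Membership in a block by coordinates: `y ∈ B^j(x) ↔ 0 ≤ (y − x)_κ < n` for all `κ`. [cite: Balaban1985Averaging, (2) p.17] -/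
theorem mem_block {x y : Site d} : y ∈ block n x ↔ ∀ κ, 0 ≤ (y - x) κ ∧ (y - x) κ < n := by
  constructor
  · intro h κ
    obtain ⟨r, -, rfl⟩ := Finset.mem_image.mp h
    simp only [add_sub_cancel_left, boxVec]
    exact ⟨by positivity, by exact_mod_cast (r κ).isLt⟩
  · intro h
    refine Finset.mem_image.mpr ⟨fun κ => ⟨((y - x) κ).toNat, ?_⟩, Finset.mem_univ _, ?_⟩
    · have h1 := (h κ).1
      have h2 := (h κ).2
      omega
    · funext κ
      have h1 := (h κ).1
      simp only [Pi.add_apply, Pi.sub_apply, boxVec] at h1 ⊢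
      omega

/-- The coordinates of a sub-plaquette corner relative to `x₀`. [cite: Balaban1985UV3, (69) p.273] -/
theorem corner_sub_apply (t : Idx d n) (κ : Fin d) :
    (corner n x₀ μ ν t - x₀) κ =
      (t.1 κ : ℤ) + (if κ = μ then ((t.2.1 : ℕ) : ℤ) else 0) + (if κ = ν then ((t.2.2 : ℕ) : ℤ) else 0) := by
  simp only [corner, boxVec, Pi.add_apply, Pi.sub_apply, Pi.smul_apply, e_apply, smul_eq_mul, mul_ite, mul_one,
    mul_zero]
  ring

/-- **Every sub-plaquette of every translate `(p′)_x`, `x ∈ B^j(x₀)`, lies in `Δ′`** (lower-left corner in the box;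
`μ ≠ ν`). [cite: Balaban1985UV3, (70) p.273] -/
theorem corner_mem_deltaBox (hμν : μ ≠ ν) (t : Idx d n) : corner n x₀ μ ν t ∈ deltaBox n x₀ μ ν := by
  rw [mem_deltaBox]
  intro κ
  rw [corner_sub_apply]
  have hr : ((t.1 κ : ℕ) : ℤ) < n := by exact_mod_cast (t.1 κ).isLt
  have hr0 : (0 : ℤ) ≤ (t.1 κ : ℕ) := by positivity
  have hi : ((t.2.1 : ℕ) : ℤ) < n := by exact_mod_cast t.2.1.isLt
  have hi0 : (0 : ℤ) ≤ (t.2.1 : ℕ) := by positivity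
  have hi' : ((t.2.2 : ℕ) : ℤ) < n := by exact_mod_cast t.2.2.isLt
  have hi'0 : (0 : ℤ) ≤ (t.2.2 : ℕ) := by positivity
  unfold side
  rcases eq_or_ne κ μ with hκμ | hκμ
  · have hκν : κ ≠ ν := fun h => hμν (hκμ.symm.trans h)
    rw [if_pos hκμ, if_neg hκν, if_pos (Or.inl hκμ)]
    push_cast
    constructor <;> linarith
  · rcases eq_or_ne κ ν with hκν | hκν
    · rw [if_neg hκμ, if_pos hκν, if_pos (Or.inr hκν)]
      push_cast
      constructor <;> linarith
    · rw [if_neg hκμ, if_neg hκν, if_neg (not_or.mpr ⟨hκμ, hκν⟩)]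
      constructor <;> linarith

/-- `boxVec` is injective (a block point determines its offset). [folklore] -/
private theorem boxVec_injective : Function.Injective (boxVec (d := d) n) := by
  intro r r' h
  funext κ
  have hκ := congrFun h κ
  simp only [boxVec, Nat.cast_inj] at hκ
  exact Fin.ext hκ

/-- **The multiplicity count behind the `L^j` of (70), line 2:** a fine plaquette (corner `y`, parallel to `p′`) is
a sub-plaquette of at most `n² = L^{2j}` translates `(p′)_x` with `x ∈ B^j(x₀)` — for each of the `n²` positions
`(i, i′)` inside a translate there is at most one block point `x`. [cite: Balaban1985UV3, (70) p.273] -/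
theorem card_fiber_corner_le (y : Site d) :
    ((Finset.univ : Finset (Idx d n)).filter fun t => corner n x₀ μ ν t = y).card ≤ n ^ 2 := by
  classical
  have h := Finset.card_le_card_of_injOn (fun t : Idx d n => t.2)
    (s := (Finset.univ : Finset (Idx d n)).filter fun t => corner n x₀ μ ν t = y)
    (t := (Finset.univ : Finset (Fin n × Fin n))) (fun _ _ => Finset.mem_univ _) ?_
  · simpa [Finset.card_univ, Fintype.card_prod, Fintype.card_fin, sq] using h
  · intro t ht t' ht' hq
    have hc : corner n x₀ μ ν t = corner n x₀ μ ν t' := by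
      rw [(Finset.mem_filter.mp (Finset.mem_coe.mp ht)).2, (Finset.mem_filter.mp (Finset.mem_coe.mp ht')).2]
    have hq' : t.2 = t'.2 := hq
    have h1 : boxVec n t.1 = boxVec n t'.1 := by
      simp only [corner, hq', add_left_inj, add_right_inj] at hc
      exact hc
    exact Prod.ext (boxVec_injective n h1) hq'

/-- **`Δ′ = B^j(x₀) ∪ B^j(y₀) ∪ B^j(z₀) ∪ B^j(w₀)`** for `p′ = ⟨x₀, y₀, z₀, w₀⟩`, i.e. `y₀ = x₀ + n e_μ`,
`z₀ = x₀ + n e_μ + n e_ν`, `w₀ = x₀ + n e_ν` on the fine lattice (`μ ≠ ν`). [cite: Balaban1985UV3, (70) p.273] -/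
theorem deltaBox_eq_union_blocks (hμν : μ ≠ ν) :
    deltaBox n x₀ μ ν =
      block n x₀ ∪ block n (x₀ + (n : ℤ) • e μ) ∪ block n (x₀ + (n : ℤ) • e μ + (n : ℤ) • e ν)
        ∪ block n (x₀ + (n : ℤ) • e ν) := by
  ext y
  simp only [Finset.mem_union, mem_deltaBox, mem_block]
  -- coordinates relative to the four corners
  have cμ : ∀ κ, (y - (x₀ + (n : ℤ) • e μ)) κ = (y - x₀) κ - (if κ = μ then (n : ℤ) else 0) := by
    intro κ
    simp only [Pi.sub_apply, Pi.add_apply, Pi.smul_apply, e_apply, smul_eq_mul, mul_ite, mul_one, mul_zero]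
    ring
  have cν : ∀ κ, (y - (x₀ + (n : ℤ) • e ν)) κ = (y - x₀) κ - (if κ = ν then (n : ℤ) else 0) := by
    intro κ
    simp only [Pi.sub_apply, Pi.add_apply, Pi.smul_apply, e_apply, smul_eq_mul, mul_ite, mul_one, mul_zero]
    ring
  have cμν : ∀ κ, (y - (x₀ + (n : ℤ) • e μ + (n : ℤ) • e ν)) κ =
      (y - x₀) κ - (if κ = μ then (n : ℤ) else 0) - (if κ = ν then (n : ℤ) else 0) := by
    intro κ
    simp only [Pi.sub_apply, Pi.add_apply, Pi.smul_apply, e_apply, smul_eq_mul, mul_ite, mul_one, mul_zero]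
    ring
  simp only [cμ, cν, cμν, side]
  constructor
  · intro h
    have hμ := h μ
    have hν := h ν
    rw [if_pos (Or.inl rfl)] at hμ
    rw [if_pos (Or.inr rfl)] at hν
    push_cast at hμ hν
    -- evaluate the box bounds at a generic coordinate
    have gen : ∀ κ, κ ≠ μ → κ ≠ ν → 0 ≤ (y - x₀) κ ∧ (y - x₀) κ < n := by
      intro κ hκμ hκν
      have := h κ
      rw [if_neg (not_or.mpr ⟨hκμ, hκν⟩)] at this
      exact this
    by_cases hm : (y - x₀) μ < n
    · by_cases hn' : (y - x₀) ν < n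
      · refine Or.inl (Or.inl (Or.inl fun κ => ?_))
        rcases eq_or_ne κ μ with rfl | hκμ
        · exact ⟨hμ.1, hm⟩
        rcases eq_or_ne κ ν with rfl | hκν
        · exact ⟨hν.1, hn'⟩
        exact gen κ hκμ hκν
      · refine Or.inr fun κ => ?_
        rcases eq_or_ne κ μ with rfl | hκμ
        · rw [if_neg hμν]; exact ⟨by linarith, by linarith⟩
        rcases eq_or_ne κ ν with rfl | hκν
        · rw [if_pos rfl]; constructor <;> linarith
        rw [if_neg hκν]; simpa using gen κ hκμ hκν
    · by_cases hn' : (y - x₀) ν < n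
      · refine Or.inl (Or.inl (Or.inr fun κ => ?_))
        rcases eq_or_ne κ μ with rfl | hκμ
        · rw [if_pos rfl]; constructor <;> linarith
        rcases eq_or_ne κ ν with rfl | hκν
        · rw [if_neg hκμ]; exact ⟨by linarith, by linarith⟩
        rw [if_neg hκμ]; simpa using gen κ hκμ hκν
      · refine Or.inl (Or.inr fun κ => ?_)
        rcases eq_or_ne κ μ with rfl | hκμ
        · rw [if_pos rfl, if_neg hμν]; constructor <;> linarith
        rcases eq_or_ne κ ν with rfl | hκν
        · rw [if_neg hκμ, if_pos rfl]; constructor <;> linarith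
        rw [if_neg hκμ, if_neg hκν]; simpa using gen κ hκμ hκν
  · rintro (((h1 | h2) | h3) | h4) <;> intro κ
    · have := h1 κ
      split_ifs with hc
      · push_cast; exact ⟨this.1, by linarith [this.2]⟩
      · exact this
    · have := h2 κ
      rcases eq_or_ne κ μ with rfl | hκμ
      · rw [if_pos rfl] at this; rw [if_pos (Or.inl rfl)]; push_cast; constructor <;> linarith [this.1, this.2]
      · rw [if_neg hκμ] at this
        split_ifs with hc
        · push_cast; exact ⟨by linarith [this.1], by linarith [this.2]⟩
        · exact ⟨by linarith [this.1], by linarith [this.2]⟩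
    · have := h3 κ
      rcases eq_or_ne κ μ with rfl | hκμ
      · have hκν : κ ≠ ν := hμν
        rw [if_pos rfl, if_neg hκν] at this; rw [if_pos (Or.inl rfl)]; push_cast
        constructor <;> linarith [this.1, this.2]
      · rw [if_neg hκμ] at this
        rcases eq_or_ne κ ν with rfl | hκν
        · rw [if_pos rfl] at this; rw [if_pos (Or.inr rfl)]; push_cast; constructor <;> linarith [this.1, this.2]
        · rw [if_neg hκν] at this; rw [if_neg (not_or.mpr ⟨hκμ, hκν⟩)]
          exact ⟨by linarith [this.1], by linarith [this.2]⟩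
    · have := h4 κ
      rcases eq_or_ne κ ν with rfl | hκν
      · rw [if_pos rfl] at this; rw [if_pos (Or.inr rfl)]; push_cast; constructor <;> linarith [this.1, this.2]
      · rw [if_neg hκν] at this
        split_ifs with hc
        · push_cast; exact ⟨by linarith [this.1], by linarith [this.2]⟩
        · exact ⟨by linarith [this.1], by linarith [this.2]⟩

end Geometry

/-! ## §3 **(70)**: squaring the block-averaged sum of (69) -/

section Squaring

variable {d : ℕ} (n : ℕ) (x₀ : Site d) (μ ν : Fin d)

/-- `Σ_{p ⊂ (p′)_x} F(p)`: the sum over the `n²` sub-plaquettes of the translate of `p′` to the block point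
`x = x₀ + boxVec n r`. [cite: Balaban1985UV3, (69) p.273] -/
def innerSum (F : Site d → ℝ) (r : Fin d → Fin n) : ℝ :=
  ∑ q : Fin n × Fin n, F (corner n x₀ μ ν (r, q))

/-- **The right-hand side sum of (69)**: `S = Σ_{x∈B^j(x₀)} L^{−3j} Σ_{p⊂(p′)_x} F(p)` with `F(p) = |U_k(∂p) − 1|`
(general `d`: weight `(n^d)⁻¹`, `n = L^j`). [cite: Balaban1985UV3, (69) p.273] -/
def blockSum (F : Site d → ℝ) : ℝ :=
  ∑ r : Fin d → Fin n, ((n : ℝ) ^ d)⁻¹ * innerSum n x₀ μ ν F r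

/-- `innerSum` as the iterated double sum `Σ_{i<n} Σ_{i′<n}` of (69). [cite: Balaban1985UV3, (69) p.273] -/
theorem innerSum_eq (F : Site d → ℝ) (r : Fin d → Fin n) :
    innerSum n x₀ μ ν F r = ∑ i : Fin n, ∑ i' : Fin n, F (corner n x₀ μ ν (r, i, i')) := by
  unfold innerSum
  rw [Fintype.sum_prod_type]

/-- `blockSum` as the printed iterated sum `Σ_x L^{−3j} Σ_i Σ_{i′}`. [cite: Balaban1985UV3, (69) p.273] -/
theorem blockSum_eq (F : Site d → ℝ) :
    blockSum n x₀ μ ν F =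
      ∑ r : Fin d → Fin n, ((n : ℝ) ^ d)⁻¹ * ∑ i : Fin n, ∑ i' : Fin n, F (corner n x₀ μ ν (r, i, i')) := by
  unfold blockSum
  simp only [innerSum_eq]

/-- The total (unweighted) double sum `Σ_{x∈B^j(x₀)} Σ_{p⊂(p′)_x}` of (69)/(70) as a sum over the index type.
[cite: Balaban1985UV3, (69) p.273] -/
theorem sum_idx_eq (G : Site d → ℝ) :
    ∑ t : Idx d n, G (corner n x₀ μ ν t) = ∑ r : Fin d → Fin n, innerSum n x₀ μ ν G r := by
  unfold innerSum
  rw [Fintype.sum_prod_type]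

/-- The (69) sum is `≥ 0` for `F ≥ 0`. [cite: Balaban1985UV3, (69) p.273] -/
theorem blockSum_nonneg {F : Site d → ℝ} (hF : ∀ y, 0 ≤ F y) : 0 ≤ blockSum n x₀ μ ν F :=
  Finset.sum_nonneg fun _ _ => mul_nonneg (by positivity) (Finset.sum_nonneg fun _ _ => hF _)

/-- A pointwise bound `F(p) ≤ a` on the sub-plaquettes gives `S ≤ n²·a` (the weights are a probability vector,
`B7Prop1Explicit.sum_weights`; each translate has `n²` sub-plaquettes).  With (68), `a = O(1)g_jp(g_j)L^{−2j}`,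
this is `S ≤ O(1)g_jp(g_j)` — the `A` of `B10.eq70_sq_step`. [cite: Balaban1985UV3, (68)–(70) p.273] -/
theorem blockSum_le_of_pointwise (hn : 1 ≤ n) {F : Site d → ℝ} {a : ℝ}
    (hF : ∀ t : Idx d n, F (corner n x₀ μ ν t) ≤ a) : blockSum n x₀ μ ν F ≤ (n : ℝ) ^ 2 * a := by
  unfold blockSum
  have hw := sum_weights (d := d) n hn
  calc ∑ r : Fin d → Fin n, ((n : ℝ) ^ d)⁻¹ * innerSum n x₀ μ ν F r
      ≤ ∑ r : Fin d → Fin n, ((n : ℝ) ^ d)⁻¹ * ((n : ℝ) ^ 2 * a) := by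
        refine Finset.sum_le_sum fun r _ => mul_le_mul_of_nonneg_left ?_ (by positivity)
        calc innerSum n x₀ μ ν F r ≤ ∑ _q : Fin n × Fin n, a := Finset.sum_le_sum fun q _ => hF (r, q)
          _ = (n : ℝ) ^ 2 * a := by
            rw [Finset.sum_const, Finset.card_univ, Fintype.card_prod, Fintype.card_fin, nsmul_eq_mul]
            push_cast; ring
    _ = (n : ℝ) ^ 2 * a := by rw [← Finset.sum_mul, hw, one_mul]

/-- **(70), line 1** (Jensen over the block, Cauchy–Schwarz over the sub-plaquettes):
`S² ≤ (n^d)⁻¹n² · Σ_{x∈B^j(x₀)} Σ_{p⊂(p′)_x} F(p)²` — at `d = 3`, `n = L^j` the printed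
`Σ_{x∈B^j(x₀)} L^{−j} Σ_{p⊂(p′)_x} |U_k(∂p) − 1|²`. [cite: Balaban1985UV3, (70) p.273] -/
theorem blockSum_sq_le_line1 (hn : 1 ≤ n) (F : Site d → ℝ) :
    blockSum n x₀ μ ν F ^ 2 ≤
      ((n : ℝ) ^ d)⁻¹ * (n : ℝ) ^ 2 * ∑ t : Idx d n, F (corner n x₀ μ ν t) ^ 2 := by
  have hw1 := sum_weights (d := d) n hn
  -- Jensen over the block points
  have step1 := sq_wsum_le_wsum_sq (Finset.univ : Finset (Fin d → Fin n)) (fun _ => ((n : ℝ) ^ d)⁻¹)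
    (fun r => innerSum n x₀ μ ν F r) (fun _ _ => by positivity) hw1
  -- Cauchy–Schwarz over the n² sub-plaquettes of one translate
  have step2 : ∀ r : Fin d → Fin n,
      innerSum n x₀ μ ν F r ^ 2 ≤ (n : ℝ) ^ 2 * innerSum n x₀ μ ν (fun y => F y ^ 2) r := by
    intro r
    unfold innerSum
    have h := sq_sum_le_card_mul_sum_sq (s := (Finset.univ : Finset (Fin n × Fin n)))
      (f := fun q => F (corner n x₀ μ ν (r, q)))
    rw [Finset.card_univ, Fintype.card_prod, Fintype.card_fin] at h
    push_cast at h
    simpa [sq] using h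
  have step3 : ∑ r : Fin d → Fin n, ((n : ℝ) ^ d)⁻¹ * innerSum n x₀ μ ν F r ^ 2
      ≤ ∑ r : Fin d → Fin n, ((n : ℝ) ^ d)⁻¹ * ((n : ℝ) ^ 2 * innerSum n x₀ μ ν (fun y => F y ^ 2) r) :=
    Finset.sum_le_sum fun r _ => mul_le_mul_of_nonneg_left (step2 r) (by positivity)
  calc blockSum n x₀ μ ν F ^ 2
      = (∑ r : Fin d → Fin n, ((n : ℝ) ^ d)⁻¹ * innerSum n x₀ μ ν F r) ^ 2 := rfl
    _ ≤ ∑ r : Fin d → Fin n, ((n : ℝ) ^ d)⁻¹ * innerSum n x₀ μ ν F r ^ 2 := step1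
    _ ≤ ∑ r : Fin d → Fin n, ((n : ℝ) ^ d)⁻¹ * ((n : ℝ) ^ 2 * innerSum n x₀ μ ν (fun y => F y ^ 2) r) := step3
    _ = ((n : ℝ) ^ d)⁻¹ * (n : ℝ) ^ 2 * ∑ r : Fin d → Fin n, innerSum n x₀ μ ν (fun y => F y ^ 2) r := by
        rw [Finset.mul_sum]
        refine Finset.sum_congr rfl fun r _ => ?_
        ring
    _ = ((n : ℝ) ^ d)⁻¹ * (n : ℝ) ^ 2 * ∑ t : Idx d n, F (corner n x₀ μ ν t) ^ 2 := by
        rw [sum_idx_eq n x₀ μ ν (fun y => F y ^ 2)]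

/-- **The multiplicity step of (70), line 2:** `Σ_{x∈B^j(x₀)} Σ_{p⊂(p′)_x} G(p) ≤ n² · Σ_{p⊂Δ′} G(p)` for `G ≥ 0`
(`μ ≠ ν`): each fine plaquette of `Δ′` is counted at most `n² = L^{2j}` times (`card_fiber_corner_le`).
[cite: Balaban1985UV3, (70) p.273] -/
theorem sum_idx_le_deltaBox (hμν : μ ≠ ν) {G : Site d → ℝ} (hG : ∀ y, 0 ≤ G y) :
    ∑ t : Idx d n, G (corner n x₀ μ ν t) ≤ (n : ℝ) ^ 2 * ∑ y ∈ deltaBox n x₀ μ ν, G y := by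
  classical
  have h := sum_comp_le_mul_sum (Finset.univ : Finset (Idx d n)) (deltaBox n x₀ μ ν) (corner n x₀ μ ν)
    (fun t _ => corner_mem_deltaBox n x₀ μ ν hμν t) G (fun y _ => hG y) (n ^ 2)
    (fun y _ => card_fiber_corner_le n x₀ μ ν y)
  simpa using h

/-- **(70), both steps:** `S² ≤ (n^d)⁻¹n⁴ · Σ_{p⊂Δ′} F(p)²` — at `d = 3`, `n = L^j` the printed factor `L^{j}` in front
of `Σ_{p⊂Δ′} |U_k(∂p) − 1|²`. [cite: Balaban1985UV3, (70) p.273] -/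
theorem blockSum_sq_le (hn : 1 ≤ n) (hμν : μ ≠ ν) (F : Site d → ℝ) :
    blockSum n x₀ μ ν F ^ 2 ≤ ((n : ℝ) ^ d)⁻¹ * (n : ℝ) ^ 4 * ∑ y ∈ deltaBox n x₀ μ ν, F y ^ 2 := by
  have h1 := blockSum_sq_le_line1 n x₀ μ ν hn F
  have h2 := sum_idx_le_deltaBox n x₀ μ ν hμν (G := fun y => F y ^ 2) (fun y => sq_nonneg _)
  calc blockSum n x₀ μ ν F ^ 2 ≤ _ := h1
    _ ≤ ((n : ℝ) ^ d)⁻¹ * (n : ℝ) ^ 2 * ((n : ℝ) ^ 2 * ∑ y ∈ deltaBox n x₀ μ ν, F y ^ 2) :=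
        mul_le_mul_of_nonneg_left h2 (by positivity)
    _ = ((n : ℝ) ^ d)⁻¹ * (n : ℝ) ^ 4 * ∑ y ∈ deltaBox n x₀ μ ν, F y ^ 2 := by ring

/-- **(70) as printed, both lines, with the remainder.**  Hypotheses AS PRINTED: (69) `v < S + b` for the real
`v = |Ū_k^j(∂p′) − 1| = |V_j(∂p′) − 1|` ((67)), the remainder `0 ≤ b ≤ B = O(1)(g_jp(g_j))²` of (69), and (68) in the
form `F(p) ≤ A·n⁻²` on the sub-plaquettes (`A = O(1)g_jp(g_j)`, `n⁻² = L^{−2j}`).  Conclusion: line 1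
`v² < (n^d)⁻¹n² Σ_x Σ_{p⊂(p′)_x} F(p)² + (2AB + B²)` and line 2 `v² < (n^d)⁻¹n⁴ Σ_{p⊂Δ′} F(p)² + (2AB + B²)`; the cross
terms are `B10.eq70_sq_step`. [cite: Balaban1985UV3, (70) p.273] -/
theorem ineq70 (hn : 1 ≤ n) (hμν : μ ≠ ν) {F : Site d → ℝ} (hF : ∀ y, 0 ≤ F y) {v b A B : ℝ}
    (hv : 0 ≤ v) (h69 : v < blockSum n x₀ μ ν F + b) (hb : 0 ≤ b) (hbB : b ≤ B)
    (h68 : ∀ t : Idx d n, F (corner n x₀ μ ν t) ≤ A / (n : ℝ) ^ 2) :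
    v ^ 2 < ((n : ℝ) ^ d)⁻¹ * (n : ℝ) ^ 2 * (∑ t : Idx d n, F (corner n x₀ μ ν t) ^ 2) + (2 * A * B + B ^ 2) ∧
    v ^ 2 < ((n : ℝ) ^ d)⁻¹ * (n : ℝ) ^ 4 * (∑ y ∈ deltaBox n x₀ μ ν, F y ^ 2) + (2 * A * B + B ^ 2) := by
  set s := blockSum n x₀ μ ν F with hs
  have hs0 : 0 ≤ s := blockSum_nonneg n x₀ μ ν hF
  have hn0 : (n : ℝ) ≠ 0 := by exact_mod_cast (by omega : n ≠ 0)
  have hsA : s ≤ A := by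
    have h := blockSum_le_of_pointwise n x₀ μ ν hn h68
    have e : (n : ℝ) ^ 2 * (A / (n : ℝ) ^ 2) = A := by field_simp
    rw [e] at h
    exact h
  have hsq : v ^ 2 < (s + b) ^ 2 := by
    have hlt : v < s + b := h69
    nlinarith [mul_pos (sub_pos.mpr hlt) (by linarith : 0 < s + b + v)]
  have hstep := B10.eq70_sq_step s b A B hs0 hsA hb hbB
  have h1 := blockSum_sq_le_line1 n x₀ μ ν hn F
  have h2 := blockSum_sq_le n x₀ μ ν hn hμν F
  constructor <;> linarith

/-- **(70), second line through the action density:** if `|U(∂p) − 1|² ≤ 2·act(p)` on `Δ′` ((11) p. 258: equality with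
`act = 1 − Re tr U(∂p)` in the normalized Hilbert–Schmidt reading, `B10Eq11Trace.eq11_normalized`; the inequality with
`act = N(1 − Re tr U(∂p))` in the operator-norm reading, `B10Eq11Trace.eq11_opNorm` / §6 below), then
`v² < 2(n^d)⁻¹n⁴ Σ_{p⊂Δ′} act(p) + (2AB + B²)` — at `d = 3` the printed `2 Σ_{p⊂Δ′} L^j[1 − Re tr U_k(∂p)] +
O(1)(g_jp(g_j))³`. [cite: Balaban1985UV3, (70) p.273] -/
theorem ineq70_act (hn : 1 ≤ n) (hμν : μ ≠ ν) {F act : Site d → ℝ} (hF : ∀ y, 0 ≤ F y)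
    (hact : ∀ y ∈ deltaBox n x₀ μ ν, F y ^ 2 ≤ 2 * act y) {v b A B : ℝ} (hv : 0 ≤ v)
    (h69 : v < blockSum n x₀ μ ν F + b) (hb : 0 ≤ b) (hbB : b ≤ B)
    (h68 : ∀ t : Idx d n, F (corner n x₀ μ ν t) ≤ A / (n : ℝ) ^ 2) :
    v ^ 2 < 2 * (((n : ℝ) ^ d)⁻¹ * (n : ℝ) ^ 4) * (∑ y ∈ deltaBox n x₀ μ ν, act y) + (2 * A * B + B ^ 2) := by
  have h := (ineq70 n x₀ μ ν hn hμν hF hv h69 hb hbB h68).2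
  have hsum : ∑ y ∈ deltaBox n x₀ μ ν, F y ^ 2 ≤ 2 * ∑ y ∈ deltaBox n x₀ μ ν, act y := by
    rw [Finset.mul_sum]
    exact Finset.sum_le_sum hact
  have hc : 0 ≤ ((n : ℝ) ^ d)⁻¹ * (n : ℝ) ^ 4 := by positivity
  nlinarith

/-- **(70) with the printed exponents** (`d = 3`, `n = L^j`): `(n³)⁻¹n² = L^{−j}` and `(n³)⁻¹n⁴ = L^{j}`:
line 1 `v² < L^{−j} Σ_x Σ_{p⊂(p′)_x} |U_k(∂p) − 1|² + (2AB + B²)`, line 2 `v² < 2L^{j} Σ_{p⊂Δ′} act(p) + (2AB + B²)`.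
[cite: Balaban1985UV3, (70) p.273] -/
theorem ineq70_d3 (L j : ℕ) (hL : 1 ≤ L) (x₀ : Site 3) (μ ν : Fin 3) (hμν : μ ≠ ν) {F act : Site 3 → ℝ}
    (hF : ∀ y, 0 ≤ F y) (hact : ∀ y ∈ deltaBox (L ^ j) x₀ μ ν, F y ^ 2 ≤ 2 * act y) {v b A B : ℝ}
    (hv : 0 ≤ v) (h69 : v < blockSum (L ^ j) x₀ μ ν F + b) (hb : 0 ≤ b) (hbB : b ≤ B)
    (h68 : ∀ t : Idx 3 (L ^ j), F (corner (L ^ j) x₀ μ ν t) ≤ A / ((L : ℝ) ^ j) ^ 2) :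
    v ^ 2 < ((L : ℝ) ^ j)⁻¹ * (∑ t : Idx 3 (L ^ j), F (corner (L ^ j) x₀ μ ν t) ^ 2) + (2 * A * B + B ^ 2) ∧
    v ^ 2 < 2 * (L : ℝ) ^ j * (∑ y ∈ deltaBox (L ^ j) x₀ μ ν, act y) + (2 * A * B + B ^ 2) := by
  have hn : 1 ≤ L ^ j := Nat.one_le_pow _ _ hL
  have hLj : ((L ^ j : ℕ) : ℝ) = (L : ℝ) ^ j := by push_cast; ring
  have hL0 : (L : ℝ) ^ j ≠ 0 := pow_ne_zero _ (by exact_mod_cast (by omega : L ≠ 0))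
  have h68' : ∀ t : Idx 3 (L ^ j), F (corner (L ^ j) x₀ μ ν t) ≤ A / ((L ^ j : ℕ) : ℝ) ^ 2 := by
    intro t; rw [hLj]; exact h68 t
  have h1 := (ineq70 (L ^ j) x₀ μ ν hn hμν hF hv h69 hb hbB h68').1
  have h2 := ineq70_act (L ^ j) x₀ μ ν hn hμν hF hact hv h69 hb hbB h68'
  have e1 : (((L ^ j : ℕ) : ℝ) ^ 3)⁻¹ * ((L ^ j : ℕ) : ℝ) ^ 2 = ((L : ℝ) ^ j)⁻¹ := by
    rw [hLj]; field_simp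
  have e2 : (((L ^ j : ℕ) : ℝ) ^ 3)⁻¹ * ((L ^ j : ℕ) : ℝ) ^ 4 = (L : ℝ) ^ j := by
    rw [hLj]; field_simp
  rw [e1] at h1
  rw [e2] at h2
  exact ⟨h1, by linarith⟩

end Squaring

/-! ## §4 **(71)**: the localized action is at least `¼p²(g_j)` -/

section Ineq71

/-- **(71) p. 273, the three printed inequalities** (`d = 3`): with `η⁻¹ = L^k`, `g_k² = g_j²L^{k−j}` (from
`g_k = g(L^kε)^{1/2}`), `actSum = Σ_{p⊂Δ′}[1 − Re tr U_k(∂p)]`, `v = |V_j(∂p′) − 1| ≥ g_jp(g_j)` (large-field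
plaquette) and (70) in the form `v² ≤ 2L^j·actSum + C₃(g_jp(g_j))³`:
`(1/g_k²)·L^k·actSum ≥ (1/2g_j²)v² − (C₃/2)g_jp³ ≥ ½p² − (C₃/2)g_jp³ ≥ ¼p²`, the last for `(C₃/2)g_jp ≤ ¼`
(*"for g_j sufficiently small"*; `B10.eq71_arith`).  O(1) = `C₃/2` explicit. [cite: Balaban1985UV3, (71) p.273] -/
theorem ineq71_chain {L : ℝ} (hL : 0 < L) {j k : ℕ} (hjk : j ≤ k) {gj gk p C₃ actSum v : ℝ}
    (hgj : 0 < gj) (hgk : gk ^ 2 = gj ^ 2 * L ^ (k - j)) (hp : 0 ≤ p) (hLF : gj * p ≤ v)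
    (h70 : v ^ 2 ≤ 2 * L ^ j * actSum + C₃ * (gj * p) ^ 3) (hsmall : C₃ / 2 * gj * p ≤ 1 / 4) :
    (2 * gj ^ 2)⁻¹ * v ^ 2 - C₃ / 2 * gj * p ^ 3 ≤ (gk ^ 2)⁻¹ * (L ^ k * actSum) ∧
    p ^ 2 / 2 - C₃ / 2 * gj * p ^ 3 ≤ (2 * gj ^ 2)⁻¹ * v ^ 2 - C₃ / 2 * gj * p ^ 3 ∧
    p ^ 2 / 4 ≤ p ^ 2 / 2 - C₃ / 2 * gj * p ^ 3 := by
  have hgj2 : 0 < gj ^ 2 := by positivity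
  have hLkj : (0 : ℝ) < L ^ (k - j) := pow_pos hL _
  have hLk : L ^ k = L ^ (k - j) * L ^ j := by rw [← pow_add, Nat.sub_add_cancel hjk]
  refine ⟨?_, ?_, B10.eq71_arith p gj (C₃ / 2) hsmall⟩
  · -- (1/g_k²) L^k actSum = (1/g_j²) L^j actSum ≥ (v² − C₃ ε³)/(2 g_j²)
    have e : (gk ^ 2)⁻¹ * (L ^ k * actSum) = (gj ^ 2)⁻¹ * (L ^ j * actSum) := by
      rw [hgk, hLk]; field_simp
    rw [e]
    have h1 : v ^ 2 - C₃ * (gj * p) ^ 3 ≤ 2 * (L ^ j * actSum) := by linarith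
    have h2 : (2 * gj ^ 2)⁻¹ * v ^ 2 - C₃ / 2 * gj * p ^ 3 = (2 * gj ^ 2)⁻¹ * (v ^ 2 - C₃ * (gj * p) ^ 3) := by
      field_simp
    rw [h2]
    have h3 : (2 * gj ^ 2)⁻¹ * (v ^ 2 - C₃ * (gj * p) ^ 3) ≤ (2 * gj ^ 2)⁻¹ * (2 * (L ^ j * actSum)) :=
      mul_le_mul_of_nonneg_left h1 (by positivity)
    calc _ ≤ _ := h3
      _ = (gj ^ 2)⁻¹ * (L ^ j * actSum) := by field_simp
  · -- v ≥ g_j p ⇒ v²/(2g_j²) ≥ p²/2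
    have hv2 : (gj * p) ^ 2 ≤ v ^ 2 := pow_le_pow_left₀ (by positivity) hLF 2
    have h4 : p ^ 2 / 2 = (2 * gj ^ 2)⁻¹ * (gj * p) ^ 2 := by field_simp
    rw [h4]
    have := mul_le_mul_of_nonneg_left hv2 (by positivity : (0 : ℝ) ≤ (2 * gj ^ 2)⁻¹)
    linarith

/-- **(71), end to end:** under the hypotheses of `ineq71_chain`, `¼p² ≤ (1/g_k²)·L^k·Σ_{p⊂Δ′}[1 − Re tr U_k(∂p)]`.
[cite: Balaban1985UV3, (71) p.273] -/
theorem ineq71 {L : ℝ} (hL : 0 < L) {j k : ℕ} (hjk : j ≤ k) {gj gk p C₃ actSum v : ℝ}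
    (hgj : 0 < gj) (hgk : gk ^ 2 = gj ^ 2 * L ^ (k - j)) (hp : 0 ≤ p) (hLF : gj * p ≤ v)
    (h70 : v ^ 2 ≤ 2 * L ^ j * actSum + C₃ * (gj * p) ^ 3) (hsmall : C₃ / 2 * gj * p ≤ 1 / 4) :
    p ^ 2 / 4 ≤ (gk ^ 2)⁻¹ * (L ^ k * actSum) := by
  obtain ⟨h1, h2, h3⟩ := ineq71_chain hL hjk hgj hgk hp hLF h70 hsmall
  linarith

end Ineq71

/-! ## §5 The statement in the vocabulary of [4] = [Balaban1985Averaging] ((42)–(43), `ℤ³`) -/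

section Printed

variable {d : ℕ} {𝔸 : Type*} [NormedRing 𝔸]

/-- The plaquette functional `p ↦ |U(∂p) − 1|` of the fine configuration, for the fine plaquettes parallel to `p′`
(lower-left corner `y`, directions `μ, ν`). [cite: Balaban1985UV3, (68)–(70) p.273] -/
def dev (U : Site d → Fin d → 𝔸ˣ) (μ ν : Fin d) (y : Site d) : ℝ :=
  ‖((hol U y (plaqWord μ ν) : 𝔸ˣ) : 𝔸) - 1‖

omit [NormedRing 𝔸] in
/-- `|U(∂p) − 1| ≥ 0`. [cite: Balaban1985UV3, (68) p.273] -/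
theorem dev_nonneg [NormedRing 𝔸] (U : Site d → Fin d → 𝔸ˣ) (μ ν : Fin d) (y : Site d) : 0 ≤ dev U μ ν y :=
  norm_nonneg _

variable [NormedAlgebra ℂ 𝔸] [CompleteSpace 𝔸]

/-- **Sect. D, (67)–(71) p. 273 for ONE large-field plaquette, `d = 3`:** let `p′` be the level-`j` plaquette at `z₀`
spanned by `e_μ, e_ν` (`μ ≠ ν`), `x₀ = L^j z₀` its fine corner, `U` the fine configuration (`U_k` on `T_η ≅ ℤ³`), `Vj`
the level-`j` field with **(67)** `Ū^j(∂p′) = V_j(∂p′)` (`Ū^j` = the concrete `j`-fold average (43) of [4],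
`B7Prop2Explicit.avgIter`) and `|V_j(∂p′) − 1| ≥ g_jp(g_j)` (large field), **(68)** `|U_k(∂p) − 1| ≤ C₁g_jp(g_j)L^{−2j}`
on the sub-plaquettes, **(69)** `|Ū^j(∂p′) − 1| < S + b` with `0 ≤ b ≤ C₂(g_jp(g_j))²`, (11) in the form
`|U(∂p) − 1|² ≤ 2·act(p)` on `Δ′`, `g_k² = g_j²L^{k−j}`, `g_jp(g_j) ≤ 1` and *"g_j sufficiently small"*:
`½(2C₁C₂ + C₂²)g_jp(g_j) ≤ ¼`.  Then **the part of `(1/g_k²)A^η(U_k)` localized in `Δ′`, `(1/g_k²)Σ_{p⊂Δ′}η⁻¹act(p)`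
(`η⁻¹ = L^k`), is `≥ ¼p²(g_j)`**.  Kernel-checked assembly of §§3–4. [cite: Balaban1985UV3, (67)–(71) p.273] -/
theorem smallFactor_of_largeField (L : ℕ) (hL : 1 ≤ L) (j k : ℕ) (hjk : j ≤ k)
    (U Vj : Site 3 → Fin 3 → 𝔸ˣ) (z₀ : Site 3) {μ ν : Fin 3} (hμν : μ ≠ ν) (act : Site 3 → ℝ)
    (hact : ∀ y ∈ deltaBox (L ^ j) ((L ^ j : ℕ) • z₀) μ ν, dev U μ ν y ^ 2 ≤ 2 * act y)
    {gj gk p b C₁ C₂ : ℝ} (hgj : 0 < gj) (hgk : gk ^ 2 = gj ^ 2 * (L : ℝ) ^ (k - j)) (hp : 0 ≤ p)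
    (hgp : gj * p ≤ 1)
    (h67 : hol (avgIter L U j) z₀ (plaqWord μ ν) = hol Vj z₀ (plaqWord μ ν))
    (hLF : gj * p ≤ ‖((hol Vj z₀ (plaqWord μ ν) : 𝔸ˣ) : 𝔸) - 1‖)
    (h68 : ∀ t : Idx 3 (L ^ j), dev U μ ν (corner (L ^ j) ((L ^ j : ℕ) • z₀) μ ν t) ≤
      C₁ * (gj * p) / ((L : ℝ) ^ j) ^ 2)
    (h69 : ‖((hol (avgIter L U j) z₀ (plaqWord μ ν) : 𝔸ˣ) : 𝔸) - 1‖ <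
      blockSum (L ^ j) ((L ^ j : ℕ) • z₀) μ ν (dev U μ ν) + b)
    (hb : 0 ≤ b) (hbB : b ≤ C₂ * (gj * p) ^ 2)
    (hsmall : (2 * C₁ * C₂ + C₂ ^ 2) / 2 * gj * p ≤ 1 / 4) :
    p ^ 2 / 4 ≤ (gk ^ 2)⁻¹ * ((L : ℝ) ^ k * ∑ y ∈ deltaBox (L ^ j) ((L ^ j : ℕ) • z₀) μ ν, act y) := by
  set x₀ : Site 3 := (L ^ j : ℕ) • z₀ with hx₀
  set v : ℝ := ‖((hol Vj z₀ (plaqWord μ ν) : 𝔸ˣ) : 𝔸) - 1‖ with hv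
  have hv0 : 0 ≤ v := norm_nonneg _
  have h69' : v < blockSum (L ^ j) x₀ μ ν (dev U μ ν) + b := by rw [hv, ← h67]; exact h69
  have hε0 : 0 ≤ gj * p := by positivity
  -- (70), line 2, with A = C₁ g_j p, B = C₂ (g_j p)²
  have h70 := (ineq70_d3 L j hL x₀ μ ν hμν (F := dev U μ ν) (act := act) (fun y => dev_nonneg U μ ν y) hact
    hv0 h69' hb hbB (A := C₁ * (gj * p)) (by intro t; rw [mul_div_assoc] at *; exact h68 t)).2
  -- the cross terms: 2AB + B² ≤ (2C₁C₂ + C₂²)(g_j p)³ for g_j p ≤ 1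
  have hC2 : 0 ≤ C₂ * (gj * p) ^ 2 := hb.trans hbB
  have hcross : 2 * (C₁ * (gj * p)) * (C₂ * (gj * p) ^ 2) + (C₂ * (gj * p) ^ 2) ^ 2 ≤
      (2 * C₁ * C₂ + C₂ ^ 2) * (gj * p) ^ 3 := by
    have h4 : (gj * p) ^ 4 ≤ (gj * p) ^ 3 := by
      calc (gj * p) ^ 4 = (gj * p) ^ 3 * (gj * p) := by ring
        _ ≤ (gj * p) ^ 3 * 1 := mul_le_mul_of_nonneg_left hgp (by positivity)
        _ = (gj * p) ^ 3 := by ring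
    have hC22 : 0 ≤ C₂ ^ 2 := sq_nonneg _
    nlinarith [mul_le_mul_of_nonneg_left h4 hC22]
  have h70' : v ^ 2 ≤ 2 * (L : ℝ) ^ j * (∑ y ∈ deltaBox (L ^ j) x₀ μ ν, act y) +
      (2 * C₁ * C₂ + C₂ ^ 2) * (gj * p) ^ 3 := by linarith
  have hLpos : (0 : ℝ) < L := by exact_mod_cast (by omega : 0 < L)
  exact ineq71 hLpos hjk hgj hgk hp hLF h70' hsmall

/-- **The small factor** (p. 273: *"the corresponding part of the exponential gives the small factor
exp(−1/4p²(g_j))"*): under the hypotheses of `smallFactor_of_largeField`,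
`exp[−(1/g_k²)Σ_{p⊂Δ′}η⁻¹act(p)] ≤ exp(−¼p²(g_j))`. [cite: Balaban1985UV3, (71) p.273] -/
theorem exp_localized_le (L : ℕ) (hL : 1 ≤ L) (j k : ℕ) (hjk : j ≤ k)
    (U Vj : Site 3 → Fin 3 → 𝔸ˣ) (z₀ : Site 3) {μ ν : Fin 3} (hμν : μ ≠ ν) (act : Site 3 → ℝ)
    (hact : ∀ y ∈ deltaBox (L ^ j) ((L ^ j : ℕ) • z₀) μ ν, dev U μ ν y ^ 2 ≤ 2 * act y)
    {gj gk p b C₁ C₂ : ℝ} (hgj : 0 < gj) (hgk : gk ^ 2 = gj ^ 2 * (L : ℝ) ^ (k - j)) (hp : 0 ≤ p)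
    (hgp : gj * p ≤ 1)
    (h67 : hol (avgIter L U j) z₀ (plaqWord μ ν) = hol Vj z₀ (plaqWord μ ν))
    (hLF : gj * p ≤ ‖((hol Vj z₀ (plaqWord μ ν) : 𝔸ˣ) : 𝔸) - 1‖)
    (h68 : ∀ t : Idx 3 (L ^ j), dev U μ ν (corner (L ^ j) ((L ^ j : ℕ) • z₀) μ ν t) ≤
      C₁ * (gj * p) / ((L : ℝ) ^ j) ^ 2)
    (h69 : ‖((hol (avgIter L U j) z₀ (plaqWord μ ν) : 𝔸ˣ) : 𝔸) - 1‖ <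
      blockSum (L ^ j) ((L ^ j : ℕ) • z₀) μ ν (dev U μ ν) + b)
    (hb : 0 ≤ b) (hbB : b ≤ C₂ * (gj * p) ^ 2)
    (hsmall : (2 * C₁ * C₂ + C₂ ^ 2) / 2 * gj * p ≤ 1 / 4) :
    Real.exp (-((gk ^ 2)⁻¹ * ((L : ℝ) ^ k * ∑ y ∈ deltaBox (L ^ j) ((L ^ j : ℕ) • z₀) μ ν, act y))) ≤
      Real.exp (-(p ^ 2 / 4)) := by
  have h := smallFactor_of_largeField L hL j k hjk U Vj z₀ hμν act hact hgj hgk hp hgp h67 hLF h68 h69 hb hbB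
    hsmall
  exact Real.exp_le_exp.mpr (by linarith)

end Printed

/-! ## §6 The hypothesis `|U(∂p) − 1|² ≤ 2·act(p)` for `U(N)`-valued configurations (operator-norm reading) -/

section Matrices

open scoped Matrix.Norms.L2Operator

variable {d : ℕ} {N : ℕ} [NeZero N]

/-- **(11) p. 258 feeding (70), operator-norm reading:** for a `U(N)`-valued fine configuration (the paper's
`G ⊂ U(N)`, [Balaban1985Averaging] p. 18) every plaquette variable is unitary, so by `B10Eq11Trace.eq11_opNorm`
`|U(∂p) − 1|²_op ≤ 2·N(1 − Re tr U(∂p))` (`tr = N⁻¹Tr`): the hypothesis `hact` of §§3, 5 holds with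
`act(p) = N(1 − Re tr U(∂p))` — the dimension factor of cell DIVERGENCE D-b10.1 (with the normalized Hilbert–Schmidt
norm it is `1 − Re tr U(∂p)` exactly, `B10Eq11Trace.eq11_normalized`). [cite: Balaban1985UV3, (11) p.258, (70) p.273] -/
theorem dev_sq_le_two_act_unitary (U : Site d → Fin d → (Matrix (Fin N) (Fin N) ℂ)ˣ)
    (hU : ∀ x κ, U x κ ∈ unitaryUnits (Matrix (Fin N) (Fin N) ℂ)) (μ ν : Fin d) (y : Site d) :
    dev U μ ν y ^ 2 ≤
      2 * ((N : ℝ) * (1 - (N : ℝ)⁻¹ *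
        (((hol U y (plaqWord μ ν) : (Matrix (Fin N) (Fin N) ℂ)ˣ) : Matrix (Fin N) (Fin N) ℂ).trace.re))) := by
  have hmem : ((hol U y (plaqWord μ ν) : (Matrix (Fin N) (Fin N) ℂ)ˣ) : Matrix (Fin N) (Fin N) ℂ) ∈
      Matrix.unitaryGroup (Fin N) ℂ :=
    (mem_unitaryUnits.mp (hol_mem_of hU y (plaqWord μ ν)))
  have h := B10Eq11Trace.eq11_opNorm _ hmem
  rw [Fintype.card_fin] at h
  unfold dev
  linarith

end Matrices

/-! ## §7 (v1.1) Bridge to the kept sum of [4] (50) (`B7Eq50Linear`) and the non-strict variants -/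

section Bridge50

variable {d : ℕ} {𝔸 : Type*} [NormedRing 𝔸]

/-- `Σ_{p⊂(p′)_x} |U(∂p) − 1|` in the two spellings: `innerSum n x₀ μ ν (dev U μ ν) r` (index `(i, i′) : Fin n × Fin n`)
is `B7Eq50Linear.fineSum n U (x₀ + boxVec n r) μ ν` (index `a, b ∈ range n`). [cite: Balaban1985UV3, (69) p.273] -/
theorem innerSum_dev_eq_fineSum (n : ℕ) (U : Site d → Fin d → 𝔸ˣ) (x₀ : Site d) (μ ν : Fin d)
    (r : Fin d → Fin n) :
    innerSum n x₀ μ ν (dev U μ ν) r = B7Eq50Linear.fineSum n U (x₀ + boxVec n r) μ ν := by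
  rw [innerSum_eq, B7Eq50Linear.fineSum, Finset.sum_range]
  refine Finset.sum_congr rfl fun i _ => ?_
  rw [Finset.sum_range]
  rfl

/-- **The (69) sum in the two spellings agree:** `blockSum n x₀ μ ν (dev U μ ν) = B7Eq50Linear.blockFineAvg n U x₀ μ ν`
(`Σ_{x∈B^j(x₀)} n^{−d} Σ_{p⊂(p′)_x} |U(∂p) − 1|`, `n = L^j`), so a (69) certified with `blockFineAvg` (seat p29's
`B10Eq69Concrete`, built on `B7Eq50Linear.prop1_linear`) feeds (70)/(71) of this file by `rw`. [cite: Balaban1985UV3, (69) p.273] -/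
theorem blockSum_dev_eq_blockFineAvg (n : ℕ) (U : Site d → Fin d → 𝔸ˣ) (x₀ : Site d) (μ ν : Fin d) :
    blockSum n x₀ μ ν (dev U μ ν) = B7Eq50Linear.blockFineAvg n U x₀ μ ν := by
  unfold blockSum B7Eq50Linear.blockFineAvg
  simp only [innerSum_dev_eq_fineSum]

/-- **(70) from a NON-STRICT (69)** (`v ≤ S + b`; the tree certifies (50)/(51) of [4] with `≤`): line 2 through the
action density, `v² ≤ 2(n^d)⁻¹n⁴ Σ_{p⊂Δ′} act(p) + (2AB + B²)`. [cite: Balaban1985UV3, (70) p.273] -/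
theorem sq_le_of_le69 (n : ℕ) (x₀ : Site d) (μ ν : Fin d) (hn : 1 ≤ n) (hμν : μ ≠ ν) {F act : Site d → ℝ}
    (hF : ∀ y, 0 ≤ F y) (hact : ∀ y ∈ deltaBox n x₀ μ ν, F y ^ 2 ≤ 2 * act y) {v b A B : ℝ} (hv : 0 ≤ v)
    (h69 : v ≤ blockSum n x₀ μ ν F + b) (hb : 0 ≤ b) (hbB : b ≤ B)
    (h68 : ∀ t : Idx d n, F (corner n x₀ μ ν t) ≤ A / (n : ℝ) ^ 2) :
    v ^ 2 ≤ 2 * (((n : ℝ) ^ d)⁻¹ * (n : ℝ) ^ 4) * (∑ y ∈ deltaBox n x₀ μ ν, act y) + (2 * A * B + B ^ 2) := by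
  set s := blockSum n x₀ μ ν F with hs
  have hs0 : 0 ≤ s := blockSum_nonneg n x₀ μ ν hF
  have hn0 : (n : ℝ) ≠ 0 := by exact_mod_cast (by omega : n ≠ 0)
  have hsA : s ≤ A := by
    have h := blockSum_le_of_pointwise n x₀ μ ν hn h68
    have e : (n : ℝ) ^ 2 * (A / (n : ℝ) ^ 2) = A := by field_simp
    rw [e] at h
    exact h
  have hsq : v ^ 2 ≤ (s + b) ^ 2 := pow_le_pow_left₀ hv h69 2
  have hstep := B10.eq70_sq_step s b A B hs0 hsA hb hbB
  have h2 := blockSum_sq_le n x₀ μ ν hn hμν F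
  have hsum : ∑ y ∈ deltaBox n x₀ μ ν, F y ^ 2 ≤ 2 * ∑ y ∈ deltaBox n x₀ μ ν, act y := by
    rw [Finset.mul_sum]
    exact Finset.sum_le_sum hact
  have hc : 0 ≤ ((n : ℝ) ^ d)⁻¹ * (n : ℝ) ^ 4 := by positivity
  nlinarith

variable [NormOneClass 𝔸] [NormedAlgebra ℂ 𝔸] [CompleteSpace 𝔸]

omit [NormOneClass 𝔸] in
/-- **Sect. D (67)–(71) for one large-field plaquette, `d = 3`, with (69) in the spelling of `B7Eq50Linear` and
NON-STRICT** (`|Ū^j(∂p′) − 1| ≤ blockFineAvg (L^j) U (L^j z₀) μ ν + b`, the shape a concrete (69) built on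
`B7Eq50Linear.prop1_linear` delivers): the localized action `(1/g_k²)Σ_{p⊂Δ′}η⁻¹act(p)` is `≥ ¼p²(g_j)`; other
hypotheses as in `smallFactor_of_largeField`. [cite: Balaban1985UV3, (67)–(71) p.273] -/
theorem smallFactor_of_largeField_le (L : ℕ) (hL : 1 ≤ L) (j k : ℕ) (hjk : j ≤ k)
    (U Vj : Site 3 → Fin 3 → 𝔸ˣ) (z₀ : Site 3) {μ ν : Fin 3} (hμν : μ ≠ ν) (act : Site 3 → ℝ)
    (hact : ∀ y ∈ deltaBox (L ^ j) ((L ^ j : ℕ) • z₀) μ ν, dev U μ ν y ^ 2 ≤ 2 * act y)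
    {gj gk p b C₁ C₂ : ℝ} (hgj : 0 < gj) (hgk : gk ^ 2 = gj ^ 2 * (L : ℝ) ^ (k - j)) (hp : 0 ≤ p)
    (hgp : gj * p ≤ 1)
    (h67 : hol (avgIter L U j) z₀ (plaqWord μ ν) = hol Vj z₀ (plaqWord μ ν))
    (hLF : gj * p ≤ ‖((hol Vj z₀ (plaqWord μ ν) : 𝔸ˣ) : 𝔸) - 1‖)
    (h68 : ∀ t : Idx 3 (L ^ j), dev U μ ν (corner (L ^ j) ((L ^ j : ℕ) • z₀) μ ν t) ≤
      C₁ * (gj * p) / ((L : ℝ) ^ j) ^ 2)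
    (h69 : ‖((hol (avgIter L U j) z₀ (plaqWord μ ν) : 𝔸ˣ) : 𝔸) - 1‖ ≤
      B7Eq50Linear.blockFineAvg (L ^ j) U ((L ^ j : ℕ) • z₀) μ ν + b)
    (hb : 0 ≤ b) (hbB : b ≤ C₂ * (gj * p) ^ 2)
    (hsmall : (2 * C₁ * C₂ + C₂ ^ 2) / 2 * gj * p ≤ 1 / 4) :
    p ^ 2 / 4 ≤ (gk ^ 2)⁻¹ * ((L : ℝ) ^ k * ∑ y ∈ deltaBox (L ^ j) ((L ^ j : ℕ) • z₀) μ ν, act y) := by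
  set x₀ : Site 3 := (L ^ j : ℕ) • z₀ with hx₀
  set n : ℕ := L ^ j with hn_def
  set v : ℝ := ‖((hol Vj z₀ (plaqWord μ ν) : 𝔸ˣ) : 𝔸) - 1‖ with hv
  have hv0 : 0 ≤ v := norm_nonneg _
  have hn : 1 ≤ n := Nat.one_le_pow _ _ hL
  have hLj : ((n : ℕ) : ℝ) = (L : ℝ) ^ j := by rw [hn_def]; push_cast; ring
  have h69' : v ≤ blockSum n x₀ μ ν (dev U μ ν) + b := by
    rw [hv, ← h67, blockSum_dev_eq_blockFineAvg]; exact h69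
  have h68' : ∀ t : Idx 3 n, dev U μ ν (corner n x₀ μ ν t) ≤ C₁ * (gj * p) / (n : ℝ) ^ 2 := by
    intro t; rw [hLj]; exact h68 t
  have h70 := sq_le_of_le69 n x₀ μ ν hn hμν (F := dev U μ ν) (act := act) (fun y => dev_nonneg U μ ν y) hact
    hv0 h69' hb hbB h68'
  have e2 : (((n : ℕ) : ℝ) ^ 3)⁻¹ * ((n : ℕ) : ℝ) ^ 4 = (L : ℝ) ^ j := by
    rw [hLj]
    have hL0 : (L : ℝ) ^ j ≠ 0 := pow_ne_zero _ (by exact_mod_cast (by omega : L ≠ 0))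
    field_simp
  rw [e2] at h70
  have hC2 : 0 ≤ C₂ * (gj * p) ^ 2 := hb.trans hbB
  have hε0 : 0 ≤ gj * p := by positivity
  have hcross : 2 * (C₁ * (gj * p)) * (C₂ * (gj * p) ^ 2) + (C₂ * (gj * p) ^ 2) ^ 2 ≤
      (2 * C₁ * C₂ + C₂ ^ 2) * (gj * p) ^ 3 := by
    have h4 : (gj * p) ^ 4 ≤ (gj * p) ^ 3 := by
      calc (gj * p) ^ 4 = (gj * p) ^ 3 * (gj * p) := by ring
        _ ≤ (gj * p) ^ 3 * 1 := mul_le_mul_of_nonneg_left hgp (by positivity)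
        _ = (gj * p) ^ 3 := by ring
    have hC22 : 0 ≤ C₂ ^ 2 := sq_nonneg _
    nlinarith [mul_le_mul_of_nonneg_left h4 hC22]
  have h70' : v ^ 2 ≤ 2 * (L : ℝ) ^ j * (∑ y ∈ deltaBox n x₀ μ ν, act y) +
      (2 * C₁ * C₂ + C₂ ^ 2) * (gj * p) ^ 3 := by nlinarith
  have hLpos : (0 : ℝ) < L := by exact_mod_cast (by omega : 0 < L)
  exact ineq71 hLpos hjk hgj hgk hp hLF h70' hsmall

end Bridge50

end Literature.MathematicalPhysics.QuantumFieldTheory.Balaban1983to89.B10Eq70Squaring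

end
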